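import Summits.KontsevichZagierPeriods.Zeta5Search.WedgeDictionaryLevelDescentFaceUExt
import Summits.KontsevichZagierPeriods.Zeta5Search.WedgeDictionaryLevelDescentWeights
import HarnessLib

/-!
# The `ζ(5)`-coefficient `U(b)` on the extended face `b₁ + b₂ = N`: the value (cell `pub-zeta5`, gen-1 g7)

HONEST FRAMING: systematic search; no irrationality claim unless certified.

Factorial evaluation of the pole formula `coeffU_facePoles_stmt` (`…LevelDescentFaceUExt`):
`dval(β₁) = D′(−β₁) = (−1)^{β₁} β₁! β₂!` (`dval_face`), `Q₅(−β) = ∏_k (−1)^{m_k} m_k! C(β,m_k) · m_k! C(γ,m_k)` for `N = β + γ`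
(`Q5_eval_neg`, via `(B − m + 1)_m = m!·C(B,m)`, `poch_desc_nat`), whence the binomial form
  `U(b) · (β₁! β₂!)⁴ = 2 ∏_{j=3}^{7} (−1)^{b_j} (b_j!)² C(β₁,b_j) C(β₂,b_j)`   (`coeffU_faceExt_binom`, all shapes of the face)
and, resolving the binomials, **`coeffU_faceExt_holds : coeffU_faceExt_stmt`** — `U(b) = [faceSupp b]·faceValue b` with
`faceValue b = 2(−1)^{Σ_{j≥3} b_j} β₁! β₂! / ∏_{j=3}^{7} (c_{1j}! c_{2j}!)` (`…LevelDescentWeights`; P1's `coeffU_face_closed` was `b₁ = b₂`).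
With `levelDescentWV_of_faceExt_holds` (`…LevelDescentInduction`) this makes (LD@N) for `W` and `V` unconditional.
No irrationality content.
-/

open Finset Polynomial

namespace Summit.KontsevichZagierPeriods.Zeta5Search.WedgeDictionary

open Summit.KontsevichZagierPeriods.Zeta5Search.DualSeries
open Literature.NumberTheory.Transcendental.BallRivoal (pochPoly eval_pochPoly poch poch_neg_natCast poch_natCast_succ)

namespace LevelDescent

/-! ### Factorial evaluations -/

/-- Descending Pochhammer at an integer: `(B − m + 1)_m = m!·C(B,m)` (both sides vanish for `m > B`). -/
theorem poch_desc_nat (B m : ℕ) : poch ((B : ℚ) - m + 1) m = (m.factorial : ℚ) * (B.choose m : ℚ) := by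
  by_cases h : m ≤ B
  · have e : (B : ℚ) - m + 1 = ((B - m : ℕ) : ℚ) + 1 := by push_cast [Nat.cast_sub h]; ring
    rw [e, poch_natCast_succ, Nat.sub_add_cancel h]
  · rw [not_le] at h
    have e : (B : ℚ) - m + 1 = -(((m - B - 1 : ℕ) : ℚ)) := by
      have : ((m - B - 1 : ℕ) : ℚ) = (m : ℚ) - B - 1 := by
        rw [Nat.sub_sub, Nat.cast_sub (by omega)]; push_cast; ring
      rw [this]; ring
    rw [e, poch_neg_natCast, Nat.choose_eq_zero_of_lt (by omega : m - B - 1 < m), Nat.choose_eq_zero_of_lt h]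
    simp

/-- `dval (β₁+β₂) β₁ = D′(−β₁) = (−1)^{β₁} β₁! β₂!`. -/
theorem dval_face (β₁ β₂ : ℕ) : dval (β₁ + β₂) β₁ = (-1) ^ β₁ * (β₁.factorial : ℚ) * (β₂.factorial : ℚ) := by
  rw [← derivative_pochPoly0_eval_neg (by omega : β₁ ≤ β₁ + β₂)]
  have hA : pochPoly 0 (β₁ + β₂ + 1) = pochPoly 0 β₁ * ((X + C (β₁ : ℚ)) * pochPoly ((β₁ : ℚ) + 1) β₂) := by
    rw [show β₁ + β₂ + 1 = β₁ + (β₂ + 1) by ring, pochPoly_zero_add β₁ (β₂ + 1), pochPoly_succ_left]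
  rw [hA]
  simp only [derivative_mul, eval_mul, eval_add]
  have h0 : (X : ℚ[X]).eval (-(β₁ : ℚ)) + (C (β₁ : ℚ)).eval (-(β₁ : ℚ)) = 0 := by simp
  have h1 : (derivative (X + C (β₁ : ℚ))).eval (-(β₁ : ℚ)) = 1 := by simp
  rw [h0, h1, eval_pochPoly, eval_pochPoly, show -(β₁ : ℚ) + 0 = -(β₁ : ℚ) by ring,
    show -(β₁ : ℚ) + ((β₁ : ℚ) + 1) = ((0 : ℕ) : ℚ) + 1 by push_cast; ring, poch_neg_natCast, poch_natCast_succ,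
    Nat.choose_self, zero_add, Nat.choose_self]
  push_cast; ring

/-- `Q₅(−β) = ∏_k (−1)^{m_k} m_k! C(β, m_k) · m_k! C(γ, m_k)` for `N = β + γ` (slots `m_k = b_{k+3} ≥ 0`). -/
theorem Q5_eval_neg (b : ℕ → ℤ) (β γ : ℕ) (hN : b 0 = (β : ℤ) + γ) (hm : ∀ k ∈ range 5, 0 ≤ b (k + 1 + 1 + 1)) :
    (Q5 b).eval (-(β : ℚ)) = ∏ k ∈ range 5,
      ((-1) ^ (b (k + 1 + 1 + 1)).toNat * (((b (k + 1 + 1 + 1)).toNat.factorial : ℕ) : ℚ) *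
          (β.choose (b (k + 1 + 1 + 1)).toNat : ℚ)) *
        ((((b (k + 1 + 1 + 1)).toNat.factorial : ℕ) : ℚ) * (γ.choose (b (k + 1 + 1 + 1)).toNat : ℚ)) := by
  rw [Q5, eval_prod]
  refine prod_congr rfl fun k hk => ?_
  obtain ⟨m, hmk⟩ : ∃ m : ℕ, (b (k + 1 + 1 + 1)).toNat = m := ⟨_, rfl⟩
  have hz : ((m : ℕ) : ℤ) = b (k + 1 + 1 + 1) := by rw [← hmk]; exact Int.toNat_of_nonneg (hm k hk)
  have e : ((b 0 - b (k + 1 + 1 + 1) + 1 : ℤ) : ℚ) = (γ : ℚ) - m + 1 + β := by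
    have : (b 0 - b (k + 1 + 1 + 1) + 1 : ℤ) = (γ : ℤ) - m + 1 + β := by omega
    rw [this]; push_cast; ring
  rw [hmk, eval_mul, eval_pochPoly, eval_pochPoly, e, show -(β : ℚ) + 0 = -(β : ℚ) by ring,
    show -(β : ℚ) + ((γ : ℚ) - m + 1 + β) = (γ : ℚ) - m + 1 by ring, poch_neg_natCast, poch_desc_nat]

/-- The slot term `s(β₁,β₂;m) = (−1)^m (m!)² C(β₁,m) C(β₂,m)`. -/
def slotTerm (β₁ β₂ m : ℕ) : ℚ := (-1) ^ m * ((m.factorial : ℕ) : ℚ) ^ 2 * (β₁.choose m : ℚ) * (β₂.choose m : ℚ)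

/-- In the support: `s(β₁,β₂;m) · (β₂−m)! (β₁−m)! = (−1)^m β₁! β₂!`. -/
theorem slotTerm_mul_fact {β₁ β₂ m : ℕ} (h1 : m ≤ β₁) (h2 : m ≤ β₂) :
    slotTerm β₁ β₂ m * ((((β₂ - m).factorial : ℕ) : ℚ) * (((β₁ - m).factorial : ℕ) : ℚ)) =
      (-1) ^ m * ((β₁.factorial : ℚ) * (β₂.factorial : ℚ)) := by
  have c1 : (β₁.choose m : ℚ) * (m.factorial : ℚ) * ((β₁ - m).factorial : ℚ) = (β₁.factorial : ℚ) := by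
    exact_mod_cast Nat.choose_mul_factorial_mul_factorial h1
  have c2 : (β₂.choose m : ℚ) * (m.factorial : ℚ) * ((β₂ - m).factorial : ℚ) = (β₂.factorial : ℚ) := by
    exact_mod_cast Nat.choose_mul_factorial_mul_factorial h2
  unfold slotTerm
  linear_combination ((-1 : ℚ) ^ m * ((β₂.choose m : ℚ) * (m.factorial : ℚ) * ((β₂ - m).factorial : ℚ))) * c1 +
    ((-1 : ℚ) ^ m * (β₁.factorial : ℚ)) * c2

/-- Out of the support: `s(β₁,β₂;m) = 0` if `m > β₁` or `m > β₂`. -/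
theorem slotTerm_eq_zero {β₁ β₂ m : ℕ} (h : β₁ < m ∨ β₂ < m) : slotTerm β₁ β₂ m = 0 := by
  unfold slotTerm
  rcases h with h | h
  · rw [Nat.choose_eq_zero_of_lt h]; simp
  · rw [Nat.choose_eq_zero_of_lt h]; simp

/-! ### The binomial form of `U(b)` on the face -/

/-- **`U(b) · (β₁! β₂!)⁴ = 2 ∏_{j=3}^{7} s(β₁,β₂; b_j)`** on the extended face (all shapes). -/
theorem coeffU_faceExt_binom (b : ℕ → ℤ) (h0 : 0 ≤ b 0) (hS : ∀ j ∈ Icc 1 7, 0 ≤ b j ∧ b j ≤ b 0) (hd : 0 ≤ dOf b)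
    (h12 : b 1 + b 2 = b 0) :
    coeffU b * (((b 1).toNat.factorial : ℚ) * ((b 2).toNat.factorial : ℚ)) ^ 4 =
      2 * ∏ k ∈ range 5, slotTerm (b 1).toNat (b 2).toNat (b (k + 1 + 1 + 1)).toNat := by
  have hU := coeffU_facePoles_holds b h0 hS hd h12
  have h1 : 0 ≤ b 1 := (hS 1 (by simp)).1
  have h2 : 0 ≤ b 2 := (hS 2 (by simp)).1
  have hm : ∀ k ∈ range 5, 0 ≤ b (k + 1 + 1 + 1) := fun k hk =>
    (hS (k + 1 + 1 + 1) (by simp only [mem_Icc]; have := mem_range.1 hk; omega)).1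
  obtain ⟨β₁, e1⟩ : ∃ β₁ : ℕ, (b 1).toNat = β₁ := ⟨_, rfl⟩
  obtain ⟨β₂, e2⟩ : ∃ β₂ : ℕ, (b 2).toNat = β₂ := ⟨_, rfl⟩
  rw [e1, e2] at hU ⊢
  have hN12 : b 0 = (β₁ : ℤ) + β₂ := by omega
  have hN21 : b 0 = (β₂ : ℤ) + β₁ := by omega
  have q1 := Q5_eval_neg b β₁ β₂ hN12 hm
  have q2 := Q5_eval_neg b β₂ β₁ hN21 hm
  have q12 : (Q5 b).eval (-(β₂ : ℚ)) = (Q5 b).eval (-(β₁ : ℚ)) := by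
    rw [q1, q2]; exact prod_congr rfl fun k _ => by ring
  have qs : (Q5 b).eval (-(β₁ : ℚ)) = ∏ k ∈ range 5, slotTerm β₁ β₂ (b (k + 1 + 1 + 1)).toNat := by
    rw [q1]; exact prod_congr rfl fun k _ => by unfold slotTerm; ring
  have s1 : ((-1 : ℚ) ^ β₁) ^ 4 = 1 := by rw [← pow_mul, mul_comm, pow_mul]; norm_num
  have s2 : ((-1 : ℚ) ^ β₂) ^ 4 = 1 := by rw [← pow_mul, mul_comm, pow_mul]; norm_num
  have d1 : dval (β₁ + β₂) β₁ ^ 4 = ((β₁.factorial : ℚ) * (β₂.factorial : ℚ)) ^ 4 := by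
    rw [dval_face, mul_pow, mul_pow, s1, one_mul, ← mul_pow]
  have d2 : dval (β₁ + β₂) β₂ ^ 4 = ((β₁.factorial : ℚ) * (β₂.factorial : ℚ)) ^ 4 := by
    rw [add_comm, dval_face, mul_pow, mul_pow, s2, one_mul, ← mul_pow, mul_comm]
  have hF : ((β₁.factorial : ℚ) * (β₂.factorial : ℚ)) ^ 4 ≠ 0 := by positivity
  rw [hU]
  by_cases he : β₁ = β₂
  · rw [if_pos he, d1, div_mul_cancel₀ _ hF, qs]
  · rw [if_neg he, d1, d2, ← add_div, div_mul_cancel₀ _ hF, q12, qs]; ring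

/-- `∏_{j ∈ [3,7]} g j = ∏_{k<5} g (k+3)`. -/
theorem prod_Icc37 (g : ℕ → ℚ) : ∏ j ∈ Icc 3 7, g j = ∏ k ∈ range 5, g (k + 1 + 1 + 1) := by
  rw [show (Icc 3 7 : Finset ℕ) = Ico 3 8 from rfl, prod_Ico_eq_prod_range]
  exact prod_congr rfl fun k _ => by rw [show 3 + k = k + 1 + 1 + 1 by ring]

end LevelDescent

open LevelDescent in
/-- **`U(b) = [faceSupp b]·faceValue b` on the extended face `b₁ + b₂ = N`** — closes `coeffU_faceExt_stmt` (`…LevelDescentWeights`). -/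
theorem coeffU_faceExt_holds : coeffU_faceExt_stmt := by
  intro b h0 hS hd h12
  have hB := coeffU_faceExt_binom b h0 hS hd h12
  have h1 : 0 ≤ b 1 := (hS 1 (by simp)).1
  have h2 : 0 ≤ b 2 := (hS 2 (by simp)).1
  have hm : ∀ k ∈ range 5, 0 ≤ b (k + 1 + 1 + 1) := fun k hk =>
    (hS (k + 1 + 1 + 1) (by simp only [mem_Icc]; have := mem_range.1 hk; omega)).1
  obtain ⟨β₁, e1⟩ : ∃ β₁ : ℕ, (b 1).toNat = β₁ := ⟨_, rfl⟩
  obtain ⟨β₂, e2⟩ : ∃ β₂ : ℕ, (b 2).toNat = β₂ := ⟨_, rfl⟩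
  obtain ⟨m, hmk⟩ : ∃ m : ℕ → ℕ, ∀ k, (b (k + 1 + 1 + 1)).toNat = m k := ⟨_, fun k => rfl⟩
  have hz : ∀ k ∈ range 5, ((m k : ℕ) : ℤ) = b (k + 1 + 1 + 1) := fun k hk => by
    rw [← hmk]; exact Int.toNat_of_nonneg (hm k hk)
  rw [e1, e2] at hB
  simp only [hmk] at hB
  have hF : (((β₁.factorial : ℚ) * (β₂.factorial : ℚ)) ^ 4) ≠ 0 := by positivity
  by_cases hs : faceSupp b
  · rw [if_pos hs]
    -- support: every slot `m_k ≤ β₁, β₂`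
    have hle : ∀ k ∈ range 5, m k ≤ β₁ ∧ m k ≤ β₂ := by
      intro k hk
      have := hs (k + 1 + 1 + 1) (by simp only [mem_Icc]; have := mem_range.1 hk; omega)
      have := hz k hk
      omega
    have hD : ∀ k ∈ range 5, ((((β₂ - m k).factorial : ℕ) : ℚ) * (((β₁ - m k).factorial : ℕ) : ℚ)) ≠ 0 :=
      fun k _ => by positivity
    obtain ⟨P, hP⟩ : ∃ P : ℚ, ∏ k ∈ range 5, ((((β₂ - m k).factorial : ℕ) : ℚ) * (((β₁ - m k).factorial : ℕ) : ℚ)) = P :=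
      ⟨_, rfl⟩
    have hP0 : P ≠ 0 := by rw [← hP]; exact prod_ne_zero_iff.2 hD
    obtain ⟨F, hFF⟩ : ∃ F : ℚ, (β₁.factorial : ℚ) * (β₂.factorial : ℚ) = F := ⟨_, rfl⟩
    rw [hFF] at hB hF
    have hPi : (∏ k ∈ range 5, slotTerm β₁ β₂ (m k)) * P = (-1) ^ (∑ k ∈ range 5, m k) * F ^ 5 := by
      rw [← hP, ← hFF, ← prod_mul_distrib, prod_congr rfl fun k hk => slotTerm_mul_fact (hle k hk).1 (hle k hk).2,
        prod_mul_distrib, prod_pow_eq_pow_sum, prod_const, card_range]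
    -- `U = 2 (−1)^{Σ m} β₁! β₂! / Π`
    have hUval : coeffU b = 2 * (-1) ^ (∑ k ∈ range 5, m k) * F / P := by
      rw [eq_div_iff hP0]
      exact mul_right_cancel₀ hF (by linear_combination P * hB + 2 * hPi)
    rw [hUval]
    -- match `faceValue`
    have hsgn : sumB b + b 7 = ((∑ k ∈ range 5, m k : ℕ) : ℤ) := by
      have h3 := hz 0 (by simp); have h4 := hz 1 (by simp); have h5 := hz 2 (by simp)
      have h6 := hz 3 (by simp); have h7 := hz 4 (by simp)
      norm_num at h3 h4 h5 h6 h7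
      simp only [sumB, sum_range_succ, sum_range_zero]
      push_cast
      omega
    unfold faceValue
    rw [hsgn, zpow_natCast, prod_Icc37]
    have hfac : ∀ k ∈ range 5, facQ (b 0 - b 1 - b (k + 1 + 1 + 1)) * facQ (b 0 - b 2 - b (k + 1 + 1 + 1)) =
        (((β₂ - m k).factorial : ℕ) : ℚ) * (((β₁ - m k).factorial : ℕ) : ℚ) := by
      intro k hk
      have := hz k hk
      have := hle k hk
      unfold facQ
      rw [show (b 0 - b 1 - b (k + 1 + 1 + 1)).toNat = β₂ - m k by omega,
        show (b 0 - b 2 - b (k + 1 + 1 + 1)).toNat = β₁ - m k by omega]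
    rw [prod_congr rfl hfac, hP]
    unfold facQ
    rw [e1, e2, ← hFF]
    ring
  · rw [if_neg hs]
    -- out of the support: one slot term vanishes
    simp only [faceSupp, not_forall, not_and, not_le, exists_prop] at hs
    obtain ⟨j, hj, hneg⟩ := hs
    rw [mem_Icc] at hj
    obtain ⟨k, hk, rfl⟩ : ∃ k, k ∈ range 5 ∧ k + 1 + 1 + 1 = j := ⟨j - 3, mem_range.2 (by omega), by omega⟩
    have hzk := hz k hk
    have hzero : slotTerm β₁ β₂ (m k) = 0 := by
      apply slotTerm_eq_zero
      by_cases hc : 0 ≤ b 0 - b 1 - b (k + 1 + 1 + 1)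
      · have := hneg hc; left; omega
      · right; omega
    have hP : ∏ k ∈ range 5, slotTerm β₁ β₂ (m k) = 0 := prod_eq_zero hk hzero
    rw [hP, mul_zero] at hB
    exact (mul_eq_zero.1 hB).resolve_right hF

end Summit.KontsevichZagierPeriods.Zeta5Search.WedgeDictionary
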